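import Summits.QuantumFields.GaugeBoot.DiagonalRPTorusOddStaircase
import HarnessLib

/-!
# Readers of the mirror links on the `3 × 3` torus and the pigeonhole for plaquette tuples
(gauge-boot, L3 — the last `d = 2` cell `L = 3`, `β < 0`, 2a/3)

HONEST FRAMING (cell `pub-gaugeboot`, page 1 of every file): the venture produces certified bounds
on lattice expectations at stated coupling, gauge group, dimension and torus size; NOT a mass gap,
NOT a continuum limit, NOT a string tension; NOT Yang–Mills-summit-bearing (barriers
`FixedCouplingUltralocality`, `PerturbativeInvisibility`). Pure combinatorics of the torus `(ℤ/3)²`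
feeding the NEGATIVE structural result `DiagonalRPTorusThreeByThreeNegative.lean`; no number is
certified.

## Content (torus `(ℤ/3)²`, `i ≠ j`; notation `dg t = (t,t)`, `blk y` = the four links of the plaquette at `y`)

* READERS of the mirror links: `(dg t, j) ∈ blk y` only for `y = dg t` or `y + e_i = dg t`
  (`mem_readers_j`); `(dg t, i) ∈ blk y` only for `y = dg t` or `y + e_j = dg t` (`mem_readers_i`);
  two reader pairs met by one plaquette coincide (`readers_j_eq`, `readers_ij_eq` — diagonal
  coordinates `0, ±1` in `ℤ/3`).
* ★ `three_le_of_readers` — PIGEONHOLE: a tuple `p : Fin k → sites` meeting the three `j`-reader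
  pairs has `k ≥ 3`; ★ `exists_perm_of_readers` — a TRIPLE meeting all six reader pairs is a
  permutation of the three mirror plaquettes `dg 0, dg 1, dg 2` (`prod_eq_prod_dg` reindexes products).

Elementary. [folklore]
-/

open Finset Function

namespace Summit.QuantumFields.GaugeBoot

open Literature.MathematicalPhysics.QuantumFieldTheory

noncomputable section

namespace DiagRPTwo

/-! ## Geometry of the `3 × 3` torus around the mirror -/

section Geometry

variable {i j : Fin 2}

/-- `1 ≠ 0` in `ℤ/3`. -/
private theorem one_ne_zero_zmod3 : (1 : ZMod 3) ≠ 0 := by decide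
/-- `-1 ≠ 0` in `ℤ/3`. -/
private theorem neg_one_ne_zero_zmod3 : (-1 : ZMod 3) ≠ 0 := by decide
/-- `-1 ≠ 1` in `ℤ/3`. -/
private theorem neg_one_ne_one_zmod3 : (-1 : ZMod 3) ≠ 1 := by decide

/-- Distinct `t, t' < 3` give distinct mirror sites. -/
theorem dg_three_injective {t t' : ℕ} (ht : t < 3) (ht' : t' < 3)
    (h : (dg t : Site 2 3) = dg t') : t = t' :=
  dg_injOn (Finset.mem_coe.2 (Finset.mem_range.2 ht)) (Finset.mem_coe.2 (Finset.mem_range.2 ht')) h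

/-- A site one `i`-step below the mirror has diagonal coordinate `-1`. -/
theorem kd_eq_neg_one_of_shift_i (hij : i ≠ j) {y : Site 2 3} {t : ℕ} (h : y.shift i = dg t) :
    kd i j y = -1 := by
  have h1 := congrArg (kd i j) h
  rw [kd_shift_left hij, kd_dg] at h1
  exact eq_neg_of_add_eq_zero_left h1

/-- A site one `j`-step below the mirror has diagonal coordinate `1`. -/
theorem kd_eq_one_of_shift_j (hij : i ≠ j) {y : Site 2 3} {t : ℕ} (h : y.shift j = dg t) :
    kd i j y = 1 := by
  have h1 := congrArg (kd i j) h
  rw [kd_shift_right hij, kd_dg] at h1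
  exact sub_eq_zero.1 h1

/-- ★ READERS of the mirror `j`-link: `(dg t, j) ∈ blk y` only for `y = dg t` or `y + e_i = dg t`. -/
theorem mem_readers_j (hij : i ≠ j) {y : Site 2 3} {t : ℕ}
    (h : ((dg t, j) : Edge 2 3) ∈ blk i j y) : y = dg t ∨ y.shift i = dg t := by
  rcases mem_blk.1 h with h | h | h | h
  · exact absurd (congrArg Prod.snd h) (Ne.symm hij)
  · exact Or.inr (congrArg Prod.fst h).symm
  · exact Or.inl (congrArg Prod.fst h).symm
  · exact absurd (congrArg Prod.snd h) (Ne.symm hij)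

/-- ★ READERS of the mirror `i`-link: `(dg t, i) ∈ blk y` only for `y = dg t` or `y + e_j = dg t`. -/
theorem mem_readers_i (hij : i ≠ j) {y : Site 2 3} {t : ℕ}
    (h : ((dg t, i) : Edge 2 3) ∈ blk i j y) : y = dg t ∨ y.shift j = dg t := by
  rcases mem_blk.1 h with h | h | h | h
  · exact Or.inl (congrArg Prod.fst h).symm
  · exact absurd (congrArg Prod.snd h) hij
  · exact absurd (congrArg Prod.snd h) hij
  · exact Or.inr (congrArg Prod.fst h).symm

/-- Two `j`-reader pairs met by the same plaquette coincide. -/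
theorem readers_j_eq (hij : i ≠ j) {y : Site 2 3} {t t' : ℕ} (ht : t < 3) (ht' : t' < 3)
    (h : y = dg t ∨ y.shift i = dg t) (h' : y = dg t' ∨ y.shift i = dg t') : t = t' := by
  rcases h with h | h <;> rcases h' with h' | h'
  · exact dg_three_injective ht ht' (h.symm.trans h')
  · have := kd_eq_neg_one_of_shift_i hij h'
    rw [h, kd_dg] at this
    exact absurd this.symm neg_one_ne_zero_zmod3
  · have := kd_eq_neg_one_of_shift_i hij h
    rw [h', kd_dg] at this
    exact absurd this.symm neg_one_ne_zero_zmod3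
  · exact dg_three_injective ht ht' (h.symm.trans h')

/-- A `j`-reader pair and an `i`-reader pair met by the same plaquette: it is the common mirror
plaquette. -/
theorem readers_ij_eq (hij : i ≠ j) {y : Site 2 3} {t t' : ℕ} (ht : t < 3) (ht' : t' < 3)
    (h : y = dg t ∨ y.shift i = dg t) (h' : y = dg t' ∨ y.shift j = dg t') : t = t' ∧ y = dg t := by
  rcases h with h | h <;> rcases h' with h' | h'
  · exact ⟨dg_three_injective ht ht' (h.symm.trans h'), h⟩
  · have := kd_eq_one_of_shift_j hij h'
    rw [h, kd_dg] at this
    exact absurd this one_ne_zero_zmod3.symm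
  · have := kd_eq_neg_one_of_shift_i hij h
    rw [h', kd_dg] at this
    exact absurd this.symm neg_one_ne_zero_zmod3
  · have h1 := kd_eq_neg_one_of_shift_i hij h
    rw [kd_eq_one_of_shift_j hij h'] at h1
    exact absurd h1.symm neg_one_ne_one_zmod3

/-- The mirror `j`-link `(dg k, j)` is not read by the other mirror plaquettes. -/
theorem dgj_not_mem_blk_dg (hij : i ≠ j) {k t : ℕ} (hk : k < 3) (ht : t < 3) (htk : t ≠ k) :
    ((dg k, j) : Edge 2 3) ∉ blk i j (dg t : Site 2 3) := by
  intro h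
  rcases mem_readers_j hij h with h | h
  · exact htk (dg_three_injective ht hk h)
  · have := kd_eq_neg_one_of_shift_i hij h
    rw [kd_dg] at this
    exact neg_one_ne_zero_zmod3 this.symm

/-- The swap on sites is injective. -/
theorem siteDiagSwap_injective' {L : ℕ} : Injective (siteDiagSwap (L := L) i j) :=
  Function.Involutive.injective (siteDiagSwap_siteDiagSwap i j)

/-- `θ(y + e_j) = θy + e_i`. -/
theorem siteDiagSwap_shift_j {L : ℕ} (y : Site 2 L) :
    siteDiagSwap i j (y.shift j) = (siteDiagSwap i j y).shift i := by
  rw [siteDiagSwap_shift, Equiv.swap_apply_right]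

end Geometry

/-! ## The pigeonhole: tuples meeting all six reader pairs -/

section Pigeonhole

variable {i j : Fin 2}

/-- ★ A tuple of plaquettes meeting the three `j`-reader pairs has at least three entries. -/
theorem three_le_of_readers (hij : i ≠ j) {k : ℕ} {p : Fin k → Site 2 3}
    (hP : ∀ t : Fin 3, ∃ m, p m = dg (t : ℕ) ∨ (p m).shift i = dg (t : ℕ)) : 3 ≤ k := by
  choose f hf using hP
  have hinj : Injective f := by
    intro t t' h
    have h1 := hf t
    have h2 := hf t'
    rw [h] at h1
    exact Fin.ext (readers_j_eq hij t.isLt t'.isLt h1 h2)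
  simpa using Fintype.card_le_of_injective f hinj

/-- ★ **PIGEONHOLE**: a triple of plaquettes meeting all six reader pairs is a permutation of the
three mirror plaquettes. -/
theorem exists_perm_of_readers (hij : i ≠ j) {p : Fin 3 → Site 2 3}
    (hP : ∀ t : Fin 3, ∃ m, p m = dg (t : ℕ) ∨ (p m).shift i = dg (t : ℕ))
    (hQ : ∀ t : Fin 3, ∃ m, p m = dg (t : ℕ) ∨ (p m).shift j = dg (t : ℕ)) :
    ∃ σ : Equiv.Perm (Fin 3), ∀ t, p (σ t) = dg (t : ℕ) := by
  choose f hf using hP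
  have hinj : Injective f := by
    intro t t' h
    have h1 := hf t
    have h2 := hf t'
    rw [h] at h1
    exact Fin.ext (readers_j_eq hij t.isLt t'.isLt h1 h2)
  have hbij : Bijective f := Finite.injective_iff_bijective.1 hinj
  refine ⟨Equiv.ofBijective f hbij, fun t => ?_⟩
  rw [Equiv.ofBijective_apply]
  obtain ⟨m', hm'⟩ := hQ t
  obtain ⟨s, rfl⟩ := hbij.2 m'
  obtain ⟨hst, hs⟩ := readers_ij_eq hij s.isLt t.isLt (hf s) hm'
  have : s = t := Fin.ext hst
  subst this
  exact hs

/-- Reindexing a product along such a permutation. -/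
theorem prod_eq_prod_dg {M : Type*} [CommMonoid M] {p : Fin 3 → Site 2 3} {σ : Equiv.Perm (Fin 3)}
    (hσ : ∀ t, p (σ t) = dg (t : ℕ)) (g : Site 2 3 → M) :
    ∏ m, g (p m) = ∏ t : Fin 3, g (dg (t : ℕ)) := by
  rw [← Equiv.prod_comp σ (fun m => g (p m))]
  simp only [hσ]

end Pigeonhole

end DiagRPTwo

end

end Summit.QuantumFields.GaugeBoot
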